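import Literature.Analysis.FluidPDE.LaplaceDivFormLocalisation
import Literature.Analysis.FluidPDE.DivFormPotential
import Literature.Analysis.FluidPDE.WeylLemmaBall
import HarnessLib

/-!
# Interior Hölder estimate for `Δw = div F`: discharge of `LaplaceDivFormInteriorHolder`

Analysis/FluidPDE proofs file (everything proved, no definitions) for the named fact
`Literature.Analysis.FluidPDE.LaplaceDivFormInteriorHolder` (`NSBoundedSpatialHolder.lean`):
Gilbarg–Trudinger 2001, Thm. 8.24 — the De Giorgi–Nash–Moser interior Hölder estimate
`‖u‖_{C^α(Ω̄')} ≤ C(‖u‖_{L²(Ω)} + λ⁻¹‖f‖_q)` for `W^{1,2}` weak solutions of `Lu = Dᵢfⁱ`,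
`fⁱ ∈ L^q`, `q > n` — specialised, as the fact is, to `L = Δ`, `n = 3`, `Ω = B_R(x₀)`,
`Ω' = B_r(x₀)`. For the Laplacian the estimate is classical potential theory, and that is the
proof given here (Gilbarg–Trudinger, Ch. 2 and Ch. 4, instead of Ch. 8):

1. `setIntegral_mul_laplacian_eq_neg`: a weak solution is a very weak solution,
   `∫_B w Δφ = -∫_B ∑ⱼ Fⱼ ∂ⱼφ` for `φ ∈ C_c^∞(B)` (test the weak derivative with `∂ⱼφ`).
2. With `f = 1_B F ∈ L^p(ℝ³)` and the potential `N = ∑ⱼ (∂ⱼΓ) ⋆ fⱼ` of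
   `FluidPDE/DivFormPotential` (`ΔN = div f` in `𝓓'`, `N ∈ C^{0,1-3/p}` with
   `[N] ≲ ‖F‖_p`, `|N| ≲ R^{1-3/p}‖F‖_p` on `B̄`), the difference `H = w - N ∈ L¹(B)` is weakly
   harmonic on `B`.
3. Weyl's lemma with interior estimates (`FluidPDE/WeylLemmaBall`): `H` agrees a.e. on
   `B_{(R+r)/2}` with `H'`, `|H'| + Lip(H') ≲ ‖H‖_{L¹(B)} ≲ |B|^{1/2}‖w‖_{L²(B)} + |B| R^{1-3/p}‖F‖_p`.
4. `w' = H' + N` is the Hölder representative: `exists_holder_rep` (real exponent `3 < p < ∞`,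
   `α = 1 - 3/p`, constants depending on `p, R, r` only), and `LaplaceDivFormInteriorHolder_holds`
   (exponent `q ∈ (3, ∞]` of the fact, reduced to `p = min(q, 4)` on the finite measure space
   `B_R`, with the `HolderOnWith` packaging of the fact).

The hypothesis `∇w ∈ L²(B_R)` of the fact is not needed (for `L = Δ` very weak solutions are
already regular); the constants are not those of Thm. 8.24 (`α = α(n)` there), as the fact allows.

## References

* D. Gilbarg, N. S. Trudinger, *Elliptic Partial Differential Equations of Second Order*
  (2001): Thm. 8.24 with (8.68) (the statement discharged); (2.17), Thm. 2.10, Lemma 4.1–4.2,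
  Lemma 7.12 (the potential-theoretic proof for `L = Δ`). [`GilbargTrudinger2001`]
* H. Weyl, *The method of orthogonal projection in potential theory*, Duke Math. J. 7 (1940),
  411–444, Lemma 2.
-/

noncomputable section

open MeasureTheory Set Function Filter Topology TopologicalSpace Metric InnerProductSpace
open scoped NNReal ENNReal RealInnerProductSpace ContDiff Laplacian

namespace Literature.Analysis.FluidPDE

namespace LaplaceDivFormHolder

open SerrinBoundedHolder LaplaceDivFormLocalisation NewtonPotentialHolder

/-! ### A weak solution is a very weak solution -/

/-- The Laplacian of a test function on `U` is a test function on `U`. [folklore] -/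
theorem isTestFunctionOn_laplacian {U : Opens (EuclideanSpace ℝ (Fin 3))}
    {φ : (EuclideanSpace ℝ (Fin 3)) → ℝ} (hφ : FunctionSpaces.IsTestFunctionOn U φ) :
    FunctionSpaces.IsTestFunctionOn U (Δ φ) where
  contDiff := contDiff_laplacian (n := (⊤ : ℕ∞)) (by exact_mod_cast hφ.contDiff)
  hasCompactSupport := DivFormPotential.hasCompactSupport_laplacian hφ.hasCompactSupport
  tsupport_subset :=
    (closure_minimal (fun x hx => by
      by_contra h
      exact hx (laplacian_eq_zero_of_notMem_tsupport h)) (isClosed_tsupport φ)).trans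
      hφ.tsupport_subset

/-- **A weak solution of `Δw = div F` is a very weak solution**: if `w` has weak derivative `g`
on `B = B(x₀, R)`, `F ∈ L¹_loc(B)` and `∫_B g(∇φ) = ∫_B ⟨F, ∇φ⟩` for all `φ ∈ C_c^∞(B)`, then
`∫_B w Δφ = -∫_B ∑ⱼ Fⱼ ∂ⱼφ` for all `φ ∈ C_c^∞(B)` (test the weak derivative with `∂ⱼφ` in the
direction `eⱼ` and sum). [folklore] -/
theorem setIntegral_mul_laplacian_eq_neg {x₀ : EuclideanSpace ℝ (Fin 3)} {R : ℝ}
    {w : (EuclideanSpace ℝ (Fin 3)) → ℝ}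
    {g : (EuclideanSpace ℝ (Fin 3)) → (EuclideanSpace ℝ (Fin 3)) →L[ℝ] ℝ}
    {F : (EuclideanSpace ℝ (Fin 3)) → EuclideanSpace ℝ (Fin 3)}
    (hw : FunctionSpaces.HasWeakFDerivOn (⟨ball x₀ R, isOpen_ball⟩ : Opens _) volume w g)
    (hF : LocallyIntegrableOn F (ball x₀ R) volume)
    (heq : ∀ φ : (EuclideanSpace ℝ (Fin 3)) → ℝ,
      FunctionSpaces.IsTestFunctionOn (⟨ball x₀ R, isOpen_ball⟩ : Opens _) φ →
        ∫ x in ball x₀ R, g x (gradient φ x) = ∫ x in ball x₀ R, ⟪F x, gradient φ x⟫)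
    {φ : (EuclideanSpace ℝ (Fin 3)) → ℝ}
    (hφ : FunctionSpaces.IsTestFunctionOn (⟨ball x₀ R, isOpen_ball⟩ : Opens _) φ) :
    ∫ x in ball x₀ R, w x * (Δ φ) x =
      -∫ x in ball x₀ R, ∑ j, F x j * fderiv ℝ φ x (EuclideanSpace.single j (1 : ℝ)) := by
  have hφ2 : ContDiff ℝ 2 φ := hφ.contDiff.of_le (by norm_cast)
  have hd : ∀ j : Fin 3, FunctionSpaces.IsTestFunctionOn (⟨ball x₀ R, isOpen_ball⟩ : Opens _)
      fun x => fderiv ℝ φ x (EuclideanSpace.single j (1 : ℝ)) := fun j =>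
    isTestFunctionOn_fderiv_apply hφ _
  have hdd : ∀ j : Fin 3, FunctionSpaces.IsTestFunctionOn (⟨ball x₀ R, isOpen_ball⟩ : Opens _)
      fun x => fderiv ℝ (fun y => fderiv ℝ φ y (EuclideanSpace.single j (1 : ℝ))) x
        (EuclideanSpace.single j (1 : ℝ)) := fun j =>
    isTestFunctionOn_fderiv_apply (hd j) _
  have hgL : ∀ j : Fin 3, LocallyIntegrableOn (fun x => g x (EuclideanSpace.single j (1 : ℝ)))
      (ball x₀ R) volume := fun j =>
    (ContinuousLinearMap.apply ℝ ℝ (EuclideanSpace.single j (1 : ℝ))).locallyIntegrableOn_comp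
      hw.locallyIntegrableOn_deriv
  have hFL : ∀ j : Fin 3, LocallyIntegrableOn (fun x => F x j) (ball x₀ R) volume := fun j =>
    (EuclideanSpace.proj j : EuclideanSpace ℝ (Fin 3) →L[ℝ] ℝ).locallyIntegrableOn_comp hF
  have hI : ∀ {a G : (EuclideanSpace ℝ (Fin 3)) → ℝ},
      FunctionSpaces.IsTestFunctionOn (⟨ball x₀ R, isOpen_ball⟩ : Opens _) a →
      LocallyIntegrableOn G (ball x₀ R) volume →
      IntegrableOn (fun x => a x * G x) (ball x₀ R) volume :=
    fun ha hG => integrableOn_test_mul (U := ⟨ball x₀ R, isOpen_ball⟩) ha.contDiff.continuous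
      ha.hasCompactSupport ha.tsupport_subset hG
  -- the Laplacian in coordinates
  have hΔ : ∀ x, (Δ φ) x = ∑ j, fderiv ℝ (fun y => fderiv ℝ φ y (EuclideanSpace.single j (1 : ℝ)))
      x (EuclideanSpace.single j (1 : ℝ)) := by
    intro x
    simp only [laplacian_eq_sum_fderiv_fderiv (EuclideanSpace.basisFun (Fin 3) ℝ) hφ2,
      EuclideanSpace.basisFun_apply]
  have hL : ∫ x in ball x₀ R, w x * (Δ φ) x = ∑ j, ∫ x in ball x₀ R,
      fderiv ℝ (fun y => fderiv ℝ φ y (EuclideanSpace.single j (1 : ℝ))) x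
        (EuclideanSpace.single j (1 : ℝ)) * w x := by
    simp_rw [hΔ, Finset.mul_sum]
    rw [integral_finsetSum _ fun j _ =>
      ((hI (hdd j) hw.locallyIntegrableOn).congr_fun (fun x _ => mul_comm _ _) measurableSet_ball)]
    exact Finset.sum_congr rfl fun j _ =>
      integral_congr_ae (Eventually.of_forall fun x => mul_comm _ _)
  -- the weak derivative tested with `∂ⱼφ`
  have hW : ∀ j : Fin 3, ∫ x in ball x₀ R,
      fderiv ℝ (fun y => fderiv ℝ φ y (EuclideanSpace.single j (1 : ℝ))) x
        (EuclideanSpace.single j (1 : ℝ)) * w x =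
      -∫ x in ball x₀ R, fderiv ℝ φ x (EuclideanSpace.single j (1 : ℝ)) *
        g x (EuclideanSpace.single j (1 : ℝ)) := by
    intro j
    have h : ∫ x in ball x₀ R, fderiv ℝ (fun y => fderiv ℝ φ y (EuclideanSpace.single j (1 : ℝ)))
        x (EuclideanSpace.single j (1 : ℝ)) • w x = -∫ x in ball x₀ R,
          fderiv ℝ φ x (EuclideanSpace.single j (1 : ℝ)) • g x (EuclideanSpace.single j (1 : ℝ)) :=
      hw.integral_fderiv_smul_eq _ (EuclideanSpace.single j (1 : ℝ)) (hd j)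
    simpa only [smul_eq_mul] using h
  rw [hL, Finset.sum_congr rfl fun j _ => hW j, Finset.sum_neg_distrib,
    ← integral_finsetSum _ fun j _ => hI (hd j) (hgL j)]
  congr 1
  have h1 : ∫ x in ball x₀ R, ∑ j, fderiv ℝ φ x (EuclideanSpace.single j (1 : ℝ)) *
      g x (EuclideanSpace.single j (1 : ℝ)) = ∫ x in ball x₀ R, g x (gradient φ x) :=
    integral_congr_ae (Eventually.of_forall fun x => (dual_apply_gradient (g x) φ x).symm)
  rw [h1, heq φ hφ]
  exact integral_congr_ae (Eventually.of_forall fun x => inner_gradient_eq_sum (F x) φ x)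

/-! ### The Hölder representative for a finite exponent -/

/-- **Interior Hölder estimate for `Δw = div F`, real exponent.** For `3 < p < ∞` and
`0 < r < R` there is `C = C(p, R, r)` such that: if `w ∈ L²(B_R(x₀))` has a weak derivative on
`B_R(x₀)`, `F ∈ L^p(B_R(x₀))` and `∫ ∇w·∇φ = ∫ F·∇φ` for all `φ ∈ C_c^∞(B_R(x₀))`, then `w` agrees
a.e. on `B_r(x₀)` with `w'` satisfying `|w'| ≤ C(‖w‖₂ + ‖F‖_p)` and
`|w'(x) - w'(z)| ≤ C(‖w‖₂ + ‖F‖_p)|x - z|^{1-3/p}` on `B_r(x₀)` — Gilbarg–Trudinger Thm. 8.24 for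
`L = Δ`, proved by potential theory: `w' = H' + N` with `N` the Newtonian potential of
`div(1_B F)` and `H'` the Weyl representative of the weakly harmonic `w - N`.
[cite: GilbargTrudinger2001, Thm. 8.24 (L = Δ, n = 3, g = 0, Ω = B_R, Ω' = B_r; proof via (2.17), Thm. 2.10, Lemma 4.2, Lemma 7.12)] -/
theorem exists_holder_rep {p : ℝ} (hp : 3 < p) {R r : ℝ} (hr : 0 < r) (hrR : r < R) :
    ∃ C : ℝ, 0 ≤ C ∧ ∀ (x₀ : EuclideanSpace ℝ (Fin 3)) (w : (EuclideanSpace ℝ (Fin 3)) → ℝ)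
      (g : (EuclideanSpace ℝ (Fin 3)) → (EuclideanSpace ℝ (Fin 3)) →L[ℝ] ℝ)
      (F : (EuclideanSpace ℝ (Fin 3)) → EuclideanSpace ℝ (Fin 3)),
      FunctionSpaces.HasWeakFDerivOn (⟨ball x₀ R, isOpen_ball⟩ : Opens _) volume w g →
      MemLp w 2 (volume.restrict (ball x₀ R)) →
      MemLp F (ENNReal.ofReal p) (volume.restrict (ball x₀ R)) →
      (∀ φ : (EuclideanSpace ℝ (Fin 3)) → ℝ,
        FunctionSpaces.IsTestFunctionOn (⟨ball x₀ R, isOpen_ball⟩ : Opens _) φ →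
          ∫ x in ball x₀ R, g x (gradient φ x) = ∫ x in ball x₀ R, ⟪F x, gradient φ x⟫) →
      ∃ w' : (EuclideanSpace ℝ (Fin 3)) → ℝ, w =ᵐ[volume.restrict (ball x₀ r)] w' ∧
        (∀ x ∈ ball x₀ r, |w' x| ≤ C * ((eLpNorm w 2 (volume.restrict (ball x₀ R))).toReal +
          (eLpNorm F (ENNReal.ofReal p) (volume.restrict (ball x₀ R))).toReal)) ∧
        ∀ x ∈ ball x₀ r, ∀ z ∈ ball x₀ r, |w' x - w' z| ≤
          C * ((eLpNorm w 2 (volume.restrict (ball x₀ R))).toReal +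
            (eLpNorm F (ENNReal.ofReal p) (volume.restrict (ball x₀ R))).toReal) *
            ‖x - z‖ ^ (1 - 3 / p) := by
  have hR0 : 0 < R := hr.trans hrR
  have hp0 : 0 < p := by linarith
  have hp1 : (1 : ℝ≥0∞) ≤ ENNReal.ofReal p := ENNReal.one_le_ofReal.2 (by linarith)
  set α : ℝ := 1 - 3 / p with hα
  have hα0 : 0 < α := by rw [hα, sub_pos, div_lt_one hp0]; exact hp
  have hα1 : α ≤ 1 := by
    rw [hα, sub_le_self_iff]
    positivity
  -- the constants
  have h₁ : 0 < (R - r) / 2 := by linarith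
  obtain ⟨K, hK0, hK⟩ := WeylLemmaBall.exists_lipschitz_rep_of_weaklyHarmonic h₁
  obtain ⟨C₁, hC₁0, hC₁⟩ := DivFormPotential.abs_sum_potential_sub_le hp
  obtain ⟨C₂, hC₂0, hC₂⟩ := DivFormPotential.abs_sum_potential_le hp
  set V : ℝ := (volume (ball (0 : EuclideanSpace ℝ (Fin 3)) R)).toReal with hV
  have hV0 : 0 ≤ V := ENNReal.toReal_nonneg
  set K₁ : ℝ := V ^ (1 / 2 : ℝ) + V * (C₂ * R ^ α) with hK₁
  have hK₁0 : 0 ≤ K₁ := by positivity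
  refine ⟨K * K₁ + C₂ * R ^ α + (K * K₁ * (2 * r) ^ (1 - α) + C₁), by positivity,
    fun x₀ w g F hw hw2 hF heq => ?_⟩
  -- the ball and its measure
  set B : Set (EuclideanSpace ℝ (Fin 3)) := ball x₀ R with hB
  set μ : Measure (EuclideanSpace ℝ (Fin 3)) := volume.restrict B with hμ
  have hBvol : volume B = volume (ball (0 : EuclideanSpace ℝ (Fin 3)) R) :=
    Measure.addHaar_ball_center volume x₀ R
  have hBtop : volume B ≠ ⊤ := measure_ball_lt_top.ne
  haveI : IsFiniteMeasure μ := isFiniteMeasure_restrict.2 hBtop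
  have hμuniv : μ univ = volume B := by rw [hμ, Measure.restrict_apply_univ]
  have hBreal : volume.real B = V := by rw [measureReal_def, hBvol]
  set Sw : ℝ := (eLpNorm w 2 μ).toReal with hSw
  set SF : ℝ := (eLpNorm F (ENNReal.ofReal p) μ).toReal with hSF
  have hSw0 : 0 ≤ Sw := ENNReal.toReal_nonneg
  have hSF0 : 0 ≤ SF := ENNReal.toReal_nonneg
  -- the zero extension of `F` and its potential `N`
  set f : (EuclideanSpace ℝ (Fin 3)) → EuclideanSpace ℝ (Fin 3) := B.indicator F with hf
  have hfp : MemLp f (ENNReal.ofReal p) volume :=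
    (memLp_indicator_iff_restrict measurableSet_ball).2 hF
  have hfs : support f ⊆ ball x₀ R := support_indicator_subset
  have hfn : (eLpNorm f (ENNReal.ofReal p) volume).toReal = SF := by
    rw [hf, eLpNorm_indicator_eq_eLpNorm_restrict measurableSet_ball]
  set N : (EuclideanSpace ℝ (Fin 3)) → ℝ :=
    fun x => ∑ j, ∫ y, f y j * newtonKernelGrad j (x - y) with hN
  have hNc : Continuous N := DivFormPotential.continuous_sum_potential hp hfp hfs
  have hNbd : ∀ x ∈ closedBall x₀ R, |N x| ≤ C₂ * R ^ α * SF := fun x hx => by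
    have h := hC₂ f x₀ R hR0 hfp hfs x hx
    rwa [hfn] at h
  have hNhol : ∀ x z, |N x - N z| ≤ C₁ * SF * ‖x - z‖ ^ α := fun x z => by
    have h := hC₁ f x₀ R hfp hfs x z
    rwa [hfn] at h
  -- the weakly harmonic remainder `H = w - N`
  set H : (EuclideanSpace ℝ (Fin 3)) → ℝ := fun x => w x - N x with hH
  have hwI : IntegrableOn w B volume := hw2.integrable one_le_two
  have hNI : IntegrableOn N B volume :=
    (hNc.continuousOn.integrableOn_compact (isCompact_closedBall x₀ R)).mono_set
      ball_subset_closedBall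
  have hHI : IntegrableOn H B volume := hwI.sub hNI
  have hFI : IntegrableOn F B volume := hF.integrable hp1
  have hFloc : LocallyIntegrableOn F B volume := hFI.locallyIntegrableOn
  have hharm : ∀ φ : (EuclideanSpace ℝ (Fin 3)) → ℝ,
      FunctionSpaces.IsTestFunctionOn (⟨ball x₀ R, isOpen_ball⟩ : Opens _) φ →
        ∫ x in B, H x * (Δ φ) x = 0 := by
    intro φ hφ
    have hΔT := isTestFunctionOn_laplacian hφ
    have hI1 : IntegrableOn (fun x => (Δ φ) x * w x) B volume :=
      integrableOn_test_mul (U := ⟨ball x₀ R, isOpen_ball⟩) hΔT.contDiff.continuous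
        hΔT.hasCompactSupport hΔT.tsupport_subset hw.locallyIntegrableOn
    have hI2 : IntegrableOn (fun x => (Δ φ) x * N x) B volume :=
      integrableOn_test_mul (U := ⟨ball x₀ R, isOpen_ball⟩) hΔT.contDiff.continuous
        hΔT.hasCompactSupport hΔT.tsupport_subset (hNc.locallyIntegrable.locallyIntegrableOn _)
    have h1 := setIntegral_mul_laplacian_eq_neg hw hFloc heq hφ
    have h2 : ∫ x in B, N x * (Δ φ) x =
        -∫ x in B, ∑ j, F x j * fderiv ℝ φ x (EuclideanSpace.single j (1 : ℝ)) := by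
      rw [setIntegral_eq_integral_of_forall_compl_eq_zero fun x hx => ?_,
        DivFormPotential.integral_sum_potential_mul_laplacian hp hfp hfs hφ.contDiff
          hφ.hasCompactSupport]
      · rw [← setIntegral_eq_integral_of_forall_compl_eq_zero (s := B) fun y hy => ?_]
        · congr 1
          refine setIntegral_congr_fun measurableSet_ball fun y hy => ?_
          simp only [hf, indicator_of_mem hy]
        · simp [hf, indicator_of_notMem hy]
      · have h0 : (Δ φ) x = 0 :=
          laplacian_eq_zero_of_notMem_tsupport fun h => hx (hφ.tsupport_subset h)
        rw [h0, mul_zero]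
    have h3 : ∫ x in B, H x * (Δ φ) x = (∫ x in B, w x * (Δ φ) x) - ∫ x in B, N x * (Δ φ) x := by
      rw [← integral_sub ((hI1.congr_fun (fun x _ => mul_comm _ _) measurableSet_ball))
        ((hI2.congr_fun (fun x _ => mul_comm _ _) measurableSet_ball))]
      refine integral_congr_ae (Eventually.of_forall fun x => ?_)
      simp only [hH]
      ring
    rw [h3, h1, h2, sub_self]
  -- Weyl's lemma with interior estimates
  obtain ⟨H', hHae, hH'bd, hH'lip⟩ := hK x₀ R H hHI hharm
  -- the `L¹` bound `∫_B |H| ≤ K₁ (‖w‖₂ + ‖F‖_p)`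
  have hL1w : ∫ y in B, |w y| ≤ V ^ (1 / 2 : ℝ) * Sw := by
    have h1 : ∫ y in B, |w y| = (eLpNorm w 1 μ).toReal := by
      rw [eLpNorm_one_eq_lintegral_enorm, ← integral_norm_eq_lintegral_enorm hw2.1]
      rfl
    have h2 := eLpNorm_le_eLpNorm_mul_rpow_measure_univ (p := 1) (q := 2) (by norm_num) hw2.1
      (μ := μ) (f := w)
    have he : (1 / (1 : ℝ≥0∞).toReal - 1 / (2 : ℝ≥0∞).toReal : ℝ) = 1 / 2 := by norm_num
    rw [he, hμuniv] at h2
    have h3 := ENNReal.toReal_mono (ENNReal.mul_ne_top hw2.eLpNorm_ne_top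
      (ENNReal.rpow_ne_top_of_nonneg (by norm_num) hBtop)) h2
    rw [ENNReal.toReal_mul, ← ENNReal.toReal_rpow, hBvol] at h3
    rw [h1, mul_comm]
    exact h3
  have hL1N : ∫ y in B, |N y| ≤ V * (C₂ * R ^ α * SF) := by
    have h := norm_setIntegral_le_of_norm_le_const (μ := volume) measure_ball_lt_top
      (f := fun y => |N y|) (s := B) (C := C₂ * R ^ α * SF) fun y hy => by
        rw [Real.norm_eq_abs, abs_abs]
        exact hNbd y (ball_subset_closedBall hy)
    rw [Real.norm_eq_abs, abs_of_nonneg (integral_nonneg fun y => abs_nonneg _), hBreal] at h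
    linarith
  have hL1 : ∫ y in B, |H y| ≤ K₁ * (Sw + SF) := by
    have h1 : ∫ y in B, |H y| ≤ ∫ y in B, (|w y| + |N y|) :=
      integral_mono hHI.abs (hwI.abs.add hNI.abs) fun y => abs_sub _ _
    rw [integral_add hwI.abs hNI.abs] at h1
    have h2 : V ^ (1 / 2 : ℝ) * Sw ≤ V ^ (1 / 2 : ℝ) * (Sw + SF) :=
      mul_le_mul_of_nonneg_left (le_add_of_nonneg_right hSF0) (by positivity)
    have h3 : V * (C₂ * R ^ α * SF) ≤ V * (C₂ * R ^ α) * (Sw + SF) := by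
      rw [mul_assoc V]
      exact mul_le_mul_of_nonneg_left
        (mul_le_mul_of_nonneg_left (le_add_of_nonneg_left hSw0) (by positivity)) hV0
    calc ∫ y in B, |H y| ≤ V ^ (1 / 2 : ℝ) * Sw + V * (C₂ * R ^ α * SF) :=
          h1.trans (add_le_add hL1w hL1N)
      _ ≤ K₁ * (Sw + SF) := by rw [hK₁, add_mul]; exact add_le_add h2 h3
  have hI0 : 0 ≤ ∫ y in B, |H y| := integral_nonneg fun y => abs_nonneg _
  -- the representative
  refine ⟨fun x => H' x + N x, ?_, fun x hx => ?_, fun x hx z hz => ?_⟩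
  · have hsub : ball x₀ r ⊆ ball x₀ (R - (R - r) / 2) := ball_subset_ball (by linarith)
    filter_upwards [ae_restrict_of_ae_restrict_of_subset hsub hHae] with x hx
    show w x = H' x + N x
    rw [← hx, hH]
    ring
  · have hxR : x ∈ closedBall x₀ R := ball_subset_closedBall (ball_subset_ball hrR.le hx)
    calc |H' x + N x| ≤ |H' x| + |N x| := abs_add_le _ _
      _ ≤ K * (K₁ * (Sw + SF)) + C₂ * R ^ α * SF :=
          add_le_add ((hH'bd x).trans (mul_le_mul_of_nonneg_left hL1 hK0)) (hNbd x hxR)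
      _ ≤ K * (K₁ * (Sw + SF)) + C₂ * R ^ α * (Sw + SF) := by
          gcongr
          exact le_add_of_nonneg_left hSw0
      _ = (K * K₁ + C₂ * R ^ α) * (Sw + SF) := by ring
      _ ≤ (K * K₁ + C₂ * R ^ α + (K * K₁ * (2 * r) ^ (1 - α) + C₁)) * (Sw + SF) := by
          have h0 : (0 : ℝ) ≤ K * K₁ * (2 * r) ^ (1 - α) + C₁ := by positivity
          exact mul_le_mul_of_nonneg_right (le_add_of_nonneg_right h0) (by positivity)
  · -- distances in `B_r` are at most `2r`, so `|x - z| ≤ (2r)^{1-α} |x - z|^α`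
    have hd : ‖x - z‖ < 2 * r := by
      rw [mem_ball] at hx hz
      calc ‖x - z‖ = dist x z := (dist_eq_norm x z).symm
        _ ≤ dist x x₀ + dist z x₀ := dist_triangle_right _ _ _
        _ < 2 * r := by linarith
    have hdα : ‖x - z‖ ≤ (2 * r) ^ (1 - α) * ‖x - z‖ ^ α := by
      have h1 : ‖x - z‖ = ‖x - z‖ ^ (1 - α) * ‖x - z‖ ^ α := by
        rw [← Real.rpow_add' (norm_nonneg _) (by ring_nf; norm_num)]
        ring_nf
        rw [Real.rpow_one]
      calc ‖x - z‖ = ‖x - z‖ ^ (1 - α) * ‖x - z‖ ^ α := h1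
        _ ≤ (2 * r) ^ (1 - α) * ‖x - z‖ ^ α :=
          mul_le_mul_of_nonneg_right (Real.rpow_le_rpow (norm_nonneg _) hd.le (by linarith))
            (by positivity)
    calc |H' x + N x - (H' z + N z)| = |(H' x - H' z) + (N x - N z)| := by ring_nf
      _ ≤ |H' x - H' z| + |N x - N z| := abs_add_le _ _
      _ ≤ K * (K₁ * (Sw + SF)) * ‖x - z‖ + C₁ * SF * ‖x - z‖ ^ α :=
          add_le_add ((hH'lip x z).trans (mul_le_mul_of_nonneg_right
            (mul_le_mul_of_nonneg_left hL1 hK0) (norm_nonneg _))) (hNhol x z)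
      _ ≤ K * (K₁ * (Sw + SF)) * ((2 * r) ^ (1 - α) * ‖x - z‖ ^ α) +
            C₁ * (Sw + SF) * ‖x - z‖ ^ α := by
          gcongr
          exact le_add_of_nonneg_left hSw0
      _ = (K * K₁ * (2 * r) ^ (1 - α) + C₁) * (Sw + SF) * ‖x - z‖ ^ α := by ring
      _ ≤ (K * K₁ + C₂ * R ^ α + (K * K₁ * (2 * r) ^ (1 - α) + C₁)) * (Sw + SF) *
            ‖x - z‖ ^ α := by
          have h0 : (0 : ℝ) ≤ K * K₁ + C₂ * R ^ α := by positivity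
          exact mul_le_mul_of_nonneg_right
            (mul_le_mul_of_nonneg_right (le_add_of_nonneg_left h0) (by positivity))
            (by positivity)

end LaplaceDivFormHolder

/-! ### The discharge -/

/-- **Gilbarg–Trudinger 2001, Thm. 8.24 for the Laplacian on balls of `ℝ³`** — discharge of the
named fact `LaplaceDivFormInteriorHolder`: a `W^{1,2}(B_R)` weak solution of `Δw = ∂ⱼFⱼ`,
`F ∈ L^q(B_R)`, `q ∈ (3, ∞]`, agrees a.e. on `B_r`, `r < R`, with a function bounded by and
`α`-Hölder with constant `C(‖w‖_{L²(B_R)} + ‖F‖_{L^q(B_R)})`, for some `C = C(q, R, r)`,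
`α = α(q) > 0`. Reduced to `LaplaceDivFormHolder.exists_holder_rep` with the finite exponent
`p = min(q, 4)` (`‖F‖_p ≤ |B_R|^{1/p - 1/q} ‖F‖_q` on the finite measure space `B_R`), which is
proved by potential theory (see the module docstring).
[cite: GilbargTrudinger2001, Thm. 8.24 with (8.68) (L = Δ, g = 0, Ω = B_R, Ω' = B_r, n = 3) and the Remark after it] -/
theorem LaplaceDivFormInteriorHolder_holds : LaplaceDivFormInteriorHolder := by
  intro q R r hq hr hrR
  -- a finite exponent `P = min q 4`, `p = P.toReal > 3`
  set P : ℝ≥0∞ := min q 4 with hP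
  have hPtop : P ≠ ⊤ := ne_top_of_le_ne_top (by norm_num) (min_le_right _ _)
  have hPq : P ≤ q := min_le_left _ _
  have h3P : 3 < P := lt_min hq (by norm_num)
  set p : ℝ := P.toReal with hp
  have hPp : ENNReal.ofReal p = P := ENNReal.ofReal_toReal hPtop
  have hp3 : 3 < p := by
    have h := (ENNReal.toReal_lt_toReal (by norm_num : (3 : ℝ≥0∞) ≠ ⊤) hPtop).2 h3P
    rw [← hp] at h
    norm_num at h
    exact h
  have hα0 : 0 < 1 - 3 / p := by
    rw [sub_pos, div_lt_one (by linarith)]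
    exact hp3
  obtain ⟨C, hC0, hC⟩ := LaplaceDivFormHolder.exists_holder_rep hp3 hr hrR
  -- the volume factor comparing `‖F‖_p` and `‖F‖_q` on `B_R`
  set Vₑ : ℝ≥0∞ := volume (ball (0 : EuclideanSpace ℝ (Fin 3)) R) with hVₑ
  have hVtop : Vₑ ≠ ⊤ := measure_ball_lt_top.ne
  set e : ℝ := 1 / p - 1 / q.toReal with he
  have he0 : 0 ≤ e := by
    rw [he, sub_nonneg]
    rcases eq_or_ne q ⊤ with hq' | hq'
    · rw [hq', ENNReal.toReal_top, div_zero]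
      exact one_div_nonneg.2 (by linarith)
    · exact one_div_le_one_div_of_le (by linarith) (ENNReal.toReal_mono hq' hPq)
  set M₀ : ℝ := max 1 (Vₑ ^ e).toReal with hM₀
  have hM₀1 : 1 ≤ M₀ := le_max_left _ _
  have hCM : (((C * M₀).toNNReal : ℝ≥0) : ℝ) = C * M₀ := Real.coe_toNNReal _ (by positivity)
  refine ⟨(C * M₀).toNNReal, (1 - 3 / p).toNNReal, Real.toNNReal_pos.2 hα0,
    fun x₀ w g F hw hw2 _ hF heq => ?_⟩
  set μ : Measure (EuclideanSpace ℝ (Fin 3)) := volume.restrict (ball x₀ R) with hμ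
  haveI : IsFiniteMeasure μ := isFiniteMeasure_restrict.2 measure_ball_lt_top.ne
  have hμuniv : μ univ = Vₑ := by
    rw [hμ, Measure.restrict_apply_univ, hVₑ]
    exact Measure.addHaar_ball_center volume x₀ R
  -- `F ∈ L^p(B_R)` with `‖F‖_p ≤ M₀ ‖F‖_q`
  have hFP : MemLp F (ENNReal.ofReal p) μ := by
    rw [hPp]
    exact hF.mono_exponent hPq
  have hnormF : (eLpNorm F (ENNReal.ofReal p) μ).toReal ≤ M₀ * (eLpNorm F q μ).toReal := by
    have h1 := eLpNorm_le_eLpNorm_mul_rpow_measure_univ hPq hF.1 (μ := μ)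
    rw [hμuniv, ← hp, ← he] at h1
    have h2 := ENNReal.toReal_mono (ENNReal.mul_ne_top hF.eLpNorm_ne_top
      (ENNReal.rpow_ne_top_of_nonneg he0 hVtop)) h1
    rw [ENNReal.toReal_mul] at h2
    rw [hPp]
    calc (eLpNorm F P μ).toReal ≤ (eLpNorm F q μ).toReal * (Vₑ ^ e).toReal := h2
      _ ≤ (eLpNorm F q μ).toReal * M₀ :=
          mul_le_mul_of_nonneg_left (le_max_right _ _) ENNReal.toReal_nonneg
      _ = M₀ * (eLpNorm F q μ).toReal := mul_comm _ _
  obtain ⟨w', hae, hbd, hhol⟩ := hC x₀ w g F hw hw2 hFP heq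
  set T : ℝ≥0∞ := eLpNorm w 2 μ + eLpNorm F q μ with hT
  have hTtop : T ≠ ⊤ := ENNReal.add_ne_top.2 ⟨hw2.eLpNorm_ne_top, hF.eLpNorm_ne_top⟩
  have hS : (eLpNorm w 2 μ).toReal + (eLpNorm F (ENNReal.ofReal p) μ).toReal ≤ M₀ * T.toReal := by
    rw [hT, ENNReal.toReal_add hw2.eLpNorm_ne_top hF.eLpNorm_ne_top, mul_add]
    exact add_le_add (le_mul_of_one_le_left ENNReal.toReal_nonneg hM₀1) hnormF
  have hCS : C * ((eLpNorm w 2 μ).toReal + (eLpNorm F (ENNReal.ofReal p) μ).toReal) ≤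
      C * M₀ * T.toReal := by
    rw [mul_assoc]
    exact mul_le_mul_of_nonneg_left hS hC0
  refine ⟨w', hae, fun x hx => (hbd x hx).trans (by rw [hCM]; exact hCS), fun x hx z hz => ?_⟩
  have h := (hhol x hx z hz).trans (mul_le_mul_of_nonneg_right hCS (by positivity))
  have hcoe : ((((C * M₀).toNNReal * T.toNNReal : ℝ≥0)) : ℝ≥0∞) = ENNReal.ofReal (C * M₀) * T := by
    rw [ENNReal.coe_mul, ENNReal.coe_toNNReal hTtop]
    rfl
  rw [hcoe, edist_dist, edist_dist, Real.dist_eq, dist_eq_norm,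
    ENNReal.ofReal_rpow_of_nonneg (norm_nonneg _) (by positivity), Real.coe_toNNReal _ hα0.le]
  calc ENNReal.ofReal |w' x - w' z|
      ≤ ENNReal.ofReal (C * M₀ * T.toReal * ‖x - z‖ ^ (1 - 3 / p)) := ENNReal.ofReal_le_ofReal h
    _ = ENNReal.ofReal (C * M₀) * T * ENNReal.ofReal (‖x - z‖ ^ (1 - 3 / p)) := by
        rw [ENNReal.ofReal_mul (by positivity : 0 ≤ C * M₀ * T.toReal),
          ENNReal.ofReal_mul (by positivity : 0 ≤ C * M₀), ENNReal.ofReal_toReal hTtop]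

end Literature.Analysis.FluidPDE
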